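import Literature.NumberTheory.LFunctions.KeiperLiZeroSum
import Literature.NumberTheory.LFunctions.FordZetaZeroRecipSqSum
import Literature.NumberTheory.LFunctions.RHWave0HardyProofs
import Literature.NumberTheory.LFunctions.WeilCriterionConverse
import Literature.NumberTheory.LFunctions.WeilExplicitFormulaProofs
import HarnessLib

/-!
# Li coefficients and Weil's quadratic functional (Lagarias 2007, §3) — the case of `ζ`

LABEL (line 1): **RH-FREE corpus** — the identities (3.3)–(3.6) are unconditional; the two printed
remarks relating positivity of the Weil scalar product on the Li class to RH are typed with their
direction explicit: `RH ⟹ ⟨F,F⟩_W = Σ m(ρ)|F(ρ)|² ≥ 0` is an RH-CONSEQUENCE (explicit binder),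
«semidefinite on `L` ⟹ RH» is an RH-FREE implication (door), and their conjunction
`riemannHypothesis_iff_liWeilPairing_self_nonneg` is **RH-EQUIVALENT·PRINTED** (Weil positivity on the
Li class = Li's criterion re-read; neither side is asserted, nobody's target).  bears_on: LADDER-RH
L-C/L-P (COLUMN 4, LI), with a dictionary to COLUMN 2 (Weil).  WHAT THIS IS NOT: formalising that
`λ_n ≥ 0` IS Weil positivity at the Li test functions fixes WHICH positivity would prove RH; it does not
move RH; nothing here bears on the truth of RH.

Source: J. C. Lagarias, *Li coefficients for automorphic `L`-functions*, Ann. Inst. Fourier **57**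
(2007) 1689–1740 = arXiv:math/0404394 (held: `paper:arxiv-math_0404394`, locators `pNNNN:Lnn` below),
**§3 "Li Coefficients and Weil's Quadratic Functional"**, pp. 11–14 [Lagarias2007LiCoefficients].  This is
the held, refereed form of the boundary item F8 of the C2 corpus («Li positivity = Weil positivity at
the Li test functions»; Bombieri–Lagarias 1999 §5, not held, is the case `π = ζ` in the `x`-variable).
Typed for `π = π_triv`, i.e. for `ξ(s)` and the non-trivial zeros of `ζ` with multiplicity.
-- TODO(general form): irreducible cuspidal unitary automorphic `π` on `GL(N)` (the source's setting).

## Dictionary (paper ↦ tree)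

* "`Σ_{ρ ∈ Z(π)}` counting zeros with multiplicity, converging absolutely" (p0012:L27–28) ↦ `tsum`
  over the subtype `ZetaZeros.riemannZetaNontrivialZeros` weighted by `m(ρ) = riemannZetaZeroOrder ρ`.
* `λ_n(π) = Σ'_ρ [1 − (1 − 1/ρ)ⁿ]`, `n ∈ ℤ`, the `'` = symmetric summation (eq. (1.7) p0002) ↦
  `liCoeffZ n`, typed — as the tree's `keiperLiCoeff_eq_tsum_zeros` — as the absolutely convergent sum
  of `m(ρ) Re[1 − (1 − 1/ρ)ⁿ]` (for `ζ` the zero multiset is conjugation-symmetric, so the symmetric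
  sums are real and equal to this); `liCoeffZ n = keiperLiCoeff n` for `n ≥ 1` (`liCoeffZ_natCast`),
  `λ_{−n} = λ_n` for `ζ` (`liCoeffZ_neg`, the `ρ ↦ 1 − ρ` symmetry), `λ_0 = 0`.
* The Weil scalar product (3.1) in Suzuki's coordinates is the tree's
  `Literature.NumberTheory.LFunctions.weilHermitianTerm` (`SuzukiWeilHilbertSpace.lean`): for
  `F = weilMellin ψ₁`, `G = weilMellin ψ₂` the `ρ`-th term `m(ρ) F(ρ) conj G(1−ρ̄)` below is literally
  `weilHermitianTerm ψ₁ ψ₂ ρ` (`suzukiHat_neg_suzukiZeroParam`, `suzukiHat_neg_conj_suzukiZeroParam`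
  there); no second Weil object is introduced — (3.1) is the same hermitian form written on the
  Mellin side for arbitrary `F, G`.
* COLUMN 2 (Weil's quadratic functional `W(g ⋆ g̃) = weilQuadratic g`, Bombieri 2000 Thms 1–2): for a
  test function `g` (`IsWeilTest g`), `⟨ĝ, ĝ⟩_W` with `ĝ = weilMellin g` is LITERALLY Bombieri's zero
  form `Σ_ρ m(ρ) ĝ(ρ) conj ĝ(1−ρ̄)` (`liWeilPairing_weilMellin_eq_zeroForm`, by `rfl` up to
  reassociation) and hence, by the tree's explicit formula (`explicit_formula_holds`), equals
  `W(g ⋆ g̃)` (`liWeilPairing_weilMellin_self_eq_weilQuadratic`) — the printed sentence «(3.1) is the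
  Weil scalar product» (p0012:L21–26) kernel-checked against COLUMN 2's functional.

## Contents (source item ↦ declaration)

* (3.1) p0012:L24–26 ↦ `liWeilPairing`; (3.2) p0013:L1–2 ↦ `liTestFun`; (1.7)/(3.x) `λ_n`, `n ∈ ℤ` ↦
  `liCoeffZ` (+ `liCoeffZ_natCast`, `liCoeffZ_zero`, `liCoeffZ_neg`).
* (3.5) p0013:L22–24 ↦ `liTestFun_neg`; (3.6) p0013:L25–26 ↦ `liTestFun_mul_neg`; the reflection
  principle p0013:L20–21 ↦ `conj_liTestFun`.
* **Theorem 3.1** (3.3)–(3.4) p0013:L14–19 ↦ `Lagarias2007_thm31_zeta` (named, AS PRINTED for `ζ`) with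
  `Lagarias2007_thm31_zeta_holds` (PROVED), `liWeilPairing_liTestFun`, `liWeilPairing_liTestFun_self`.
* Remark p0012:L38–45 (RH ⟹ positive semidefinite) ↦ `liWeilPairing_self_eq_of_riemannHypothesis`,
  `liWeilPairing_self_nonneg_of_riemannHypothesis`; remark p0013:L64–66 («semidefiniteness implies
  `Re λ_n ≥ 0`; RH then follows from Theorem 2.2(2)») ↦ `riemannHypothesis_of_liWeilPairing_self_nonneg`;
  together ↦ `riemannHypothesis_iff_liWeilPairing_self_nonneg` [RH-EQUIVALENT·PRINTED]; remark
  p0014:L1–6 (RH ⟹ positive definite on `L`: a rational function has finitely many zeros) ↦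
  `liWeilPairing_self_pos_of_riemannHypothesis` (rational-function form, convergence as hypothesis) and,
  AS PRINTED on `L = span{G_n}` with no convergence hypothesis,
  `liWeilPairing_liClass_self_pos_of_riemannHypothesis` (+ RH-FREE `LiWeil.exists_zero_liClass_ne_zero`,
  `LiWeil.summable_order_mul_norm_sq_liClass`, `LiWeil.exists_lt_norm_zero`).
* Dictionary with COLUMN 2, p0012:L21–26 («the Weil scalar product ⟨f, g⟩_W») ↦
  `liWeilPairing_weilMellin_eq_zeroForm`, `liWeilPairing_weilMellin_self_eq_weilQuadratic`,
  `liWeilPairing_weilMellin_self_nonneg_of_riemannHypothesis` (RH ⟹ `W(g ⋆ g̃) ≥ 0` re-read through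
  (3.1); RH-CONSEQUENCE with its binder).

## Deliberately NOT here

* The class `A` of test functions (p0012:L11–20) as a type, and the completion `H_L(π)` (p0014:L7–8)
  — remarks; the Li class `L` enters only through its basis `{G_n}` and, in the last remark, through
  an explicit rational function `P(s)/(s^a (1−s)^b)`.
* §3 Appendix comparison with Weil's original functional (§9) — see the dictionary bullet above.

## References

* J. C. Lagarias, Ann. Inst. Fourier 57 (2007) 1689–1740 = arXiv:math/0404394, §3.
  [Lagarias2007LiCoefficients]
* E. Bombieri, J. C. Lagarias, J. Number Theory 77 (1999) 274–287, §5 (not held; the `ζ` case).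
  [BombieriLagarias1999]
* X.-J. Li, J. Number Theory 65 (1997) 325–333 (Li's criterion, tree `li_criterion_holds`). [Li1997]
-/

noncomputable section

open Complex Filter Set
open scoped ComplexConjugate Topology

namespace Literature.NumberTheory.LFunctions

open ZetaZeros

/-! ## §3 (3.1)–(3.2): the Weil scalar product on the Mellin side, the Li test functions -/

/-- **Lagarias 2007, eq. (3.1)** (p0012:L24–28), case `π = ζ`: the Weil scalar product
`⟨F, G⟩_W := Σ_{ρ} F(ρ) conj G(1 − ρ̄)`, "the sum on the right counts zeros with multiplicity, and it
converges absolutely due to the growth bound on `F` and `G`"; linear in `F`, conjugate-linear in `G`.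
Typed as the `tsum` over the non-trivial zeros of `ζ` with multiplicities (junk `0` when the family is
not summable; summability is proved below for the Li test functions and is an explicit hypothesis
elsewhere).  Termwise this is the tree's `weilHermitianTerm ψ₁ ψ₂ ρ` when `F, G` are the Mellin
transforms `weilMellin ψ₁, weilMellin ψ₂` (module docstring). [cite: Lagarias2007LiCoefficients, §3 eq. (3.1) (arXiv p0012:L24)] -/
def liWeilPairing (F G : ℂ → ℂ) : ℂ :=
  ∑' ρ : ZetaZeros.riemannZetaNontrivialZeros,
    (riemannZetaZeroOrder (ρ : ℂ) : ℂ) * (F ρ * conj (G (1 - conj (ρ : ℂ))))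

/-- **Lagarias 2007, eq. (3.2)** (p0013:L1–2): the Li test functions `G_n(s) := 1 − (1 − 1/s)ⁿ`,
`n ∈ ℤ` (`G_0 ≡ 0`; `{G_n : n ≠ 0}` is a basis of the Li class `L` of rational functions vanishing at
`∞` with polar divisor in `{0, 1}`). [cite: Lagarias2007LiCoefficients, §3 eq. (3.2) (arXiv p0013:L1)] -/
def liTestFun (n : ℤ) (s : ℂ) : ℂ :=
  1 - (1 - 1 / s) ^ n

/-- **The Li coefficients `λ_n` for all `n ∈ ℤ`** (Lagarias 2007 eq. (1.7) p0002, used in Thm 3.1 with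
negative indices): `λ_n = Σ'_ρ [1 − (1 − 1/ρ)ⁿ] = Σ'_ρ G_n(ρ)`, the symmetric sum over the zeros.  For
`ζ` typed, as `keiperLiCoeff_eq_tsum_zeros`, as the absolutely convergent real sum
`Σ_ρ m(ρ) Re G_n(ρ)` (the imaginary parts cancel in conjugate pairs).  `liCoeffZ n = keiperLiCoeff n`
for `n ≥ 1` (`liCoeffZ_natCast`). [cite: Lagarias2007LiCoefficients, §1 eq. (1.7) (arXiv p0002:L50)] -/
def liCoeffZ (n : ℤ) : ℝ :=
  ∑' ρ : ZetaZeros.riemannZetaNontrivialZeros,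
    (riemannZetaZeroOrder (ρ : ℂ) : ℝ) * (liTestFun n ρ).re

/-! ### Elementary identities for the Li test functions -/

/-- `G_0 ≡ 0`. [cite: Lagarias2007LiCoefficients, §3 (arXiv p0013:L3, "excluding `G_0(s) ≡ 0`")] -/
@[simp] theorem liTestFun_zero (s : ℂ) : liTestFun 0 s = 0 := by
  simp [liTestFun]

/-- For `n : ℕ`, `G_n(s) = 1 − (1 − 1/s)ⁿ` with the ordinary power.
[cite: Lagarias2007LiCoefficients, §3 eq. (3.2) (arXiv p0013:L1)] -/
theorem liTestFun_natCast (n : ℕ) (s : ℂ) : liTestFun n s = 1 - (1 - 1 / s) ^ n := by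
  simp [liTestFun, zpow_natCast]

/-- The reflection principle (p0013:L20–21: "each function `G_n(s)` is real on the real axis"):
`conj G_n(s) = G_n(s̄)`. [cite: Lagarias2007LiCoefficients, §3 proof of Thm 3.1 (arXiv p0013:L20)] -/
theorem conj_liTestFun (n : ℤ) (s : ℂ) : conj (liTestFun n s) = liTestFun n (conj s) := by
  simp only [liTestFun, map_sub, map_one, map_zpow₀, map_div₀]

/-- **Lagarias 2007, eq. (3.5)** (p0013:L22–24): `G_{−m}(s) = 1 − (1 − 1/s)^{−m} = 1 − (1 − 1/(s−1))^m
= G_m(1 − s)` (for `s ≠ 0, 1`). [cite: Lagarias2007LiCoefficients, §3 eq. (3.5) (arXiv p0013:L22)] -/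
theorem liTestFun_neg {s : ℂ} (hs0 : s ≠ 0) (hs1 : s ≠ 1) (m : ℤ) :
    liTestFun (-m) s = liTestFun m (1 - s) := by
  have h1s : (1 : ℂ) - s ≠ 0 := sub_ne_zero.2 (Ne.symm hs1)
  have hs1' : s - 1 ≠ 0 := sub_ne_zero.2 hs1
  have key : (1 - 1 / s)⁻¹ = 1 - 1 / (1 - s) := by
    field_simp
    ring
  simp only [liTestFun, zpow_neg, ← inv_zpow, key]

/-- **Lagarias 2007, eq. (3.6)** (p0013:L25–26): `G_n(s) G_{−m}(s) = G_n(s) + G_{−m}(s) − G_{n−m}(s)`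
(for `s ≠ 0, 1`, so that `1 − 1/s ≠ 0`). [cite: Lagarias2007LiCoefficients, §3 eq. (3.6) (arXiv p0013:L25)] -/
theorem liTestFun_mul_neg {s : ℂ} (hs0 : s ≠ 0) (hs1 : s ≠ 1) (n m : ℤ) :
    liTestFun n s * liTestFun (-m) s = liTestFun n s + liTestFun (-m) s - liTestFun (n - m) s := by
  have ha : (1 : ℂ) - 1 / s ≠ 0 := by
    intro h
    have : (1 : ℂ) / s = 1 := by linear_combination -h
    rw [div_eq_one_iff_eq hs0] at this
    exact hs1 this.symm
  simp only [liTestFun]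
  rw [show n - m = n + -m by ring, zpow_add₀ ha]
  ring

/-! ### The non-trivial zeros: `ρ ≠ 0, 1`, the symmetries `ρ ↦ ρ̄` and `ρ ↦ 1 − ρ` -/

namespace LiWeil

/-- A non-trivial zero is `≠ 0`. [folklore] -/
private theorem coe_ne_zero (ρ : ZetaZeros.riemannZetaNontrivialZeros) : (ρ : ℂ) ≠ 0 := by
  intro h
  have := riemannZetaNontrivialZeros.re_pos ρ.2
  rw [h, zero_re] at this
  exact lt_irrefl _ this

/-- A non-trivial zero is `≠ 1`. [folklore] -/
private theorem coe_ne_one (ρ : ZetaZeros.riemannZetaNontrivialZeros) : (ρ : ℂ) ≠ 1 :=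
  riemannZetaNontrivialZeros.ne_one ρ.2

/-- Complex conjugation as a self-map of the non-trivial zeros. [folklore] -/
def conjZero (ρ : ZetaZeros.riemannZetaNontrivialZeros) : ZetaZeros.riemannZetaNontrivialZeros :=
  ⟨conj (ρ : ℂ), riemannZetaNontrivialZeros.conj_mem ρ.2⟩

/-- The underlying complex number of `conjZero ρ` is `ρ̄`. [folklore] -/
private theorem coe_conjZero (ρ : ZetaZeros.riemannZetaNontrivialZeros) :
    ((conjZero ρ : ZetaZeros.riemannZetaNontrivialZeros) : ℂ) = conj (ρ : ℂ) := rfl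

/-- `conjZero` is an involution. [folklore] -/
private theorem conjZero_involutive : Function.Involutive conjZero := by
  intro ρ
  apply Subtype.ext
  simp [conjZero]

/-- Conjugation as a permutation of the zero set. [folklore] -/
def conjEquiv : Equiv.Perm ZetaZeros.riemannZetaNontrivialZeros := conjZero_involutive.toPerm _

/-- The underlying complex number of `conjEquiv ρ` is `ρ̄`. [folklore] -/
private theorem coe_conjEquiv (ρ : ZetaZeros.riemannZetaNontrivialZeros) :
    ((conjEquiv ρ : ZetaZeros.riemannZetaNontrivialZeros) : ℂ) = conj (ρ : ℂ) := rfl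

/-- `m(ρ̄) = m(ρ)` (`riemannZetaZeroOrder_conj_holds`). [folklore] -/
private theorem order_conjZero (ρ : ZetaZeros.riemannZetaNontrivialZeros) :
    riemannZetaZeroOrder ((conjZero ρ : ZetaZeros.riemannZetaNontrivialZeros) : ℂ) =
      riemannZetaZeroOrder (ρ : ℂ) :=
  riemannZetaZeroOrder_conj_holds ρ

/-- The reflection `ρ ↦ 1 − ρ` as a self-map of the non-trivial zeros. [folklore] -/
def oneSubZero (ρ : ZetaZeros.riemannZetaNontrivialZeros) : ZetaZeros.riemannZetaNontrivialZeros :=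
  ⟨1 - (ρ : ℂ), by
    have h := riemannZetaNontrivialZeros.one_sub_conj_mem (riemannZetaNontrivialZeros.conj_mem ρ.2)
    simpa using h⟩

/-- The underlying complex number of `oneSubZero ρ` is `1 − ρ`. [folklore] -/
private theorem coe_oneSubZero (ρ : ZetaZeros.riemannZetaNontrivialZeros) :
    ((oneSubZero ρ : ZetaZeros.riemannZetaNontrivialZeros) : ℂ) = 1 - (ρ : ℂ) := rfl

/-- `oneSubZero` is an involution. [folklore] -/
private theorem oneSubZero_involutive : Function.Involutive oneSubZero := by
  intro ρ
  apply Subtype.ext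
  simp [oneSubZero]

/-- `ρ ↦ 1 − ρ` as a permutation of the zero set. [folklore] -/
def oneSubEquiv : Equiv.Perm ZetaZeros.riemannZetaNontrivialZeros := oneSubZero_involutive.toPerm _

/-- The underlying complex number of `oneSubEquiv ρ` is `1 − ρ`. [folklore] -/
private theorem coe_oneSubEquiv (ρ : ZetaZeros.riemannZetaNontrivialZeros) :
    ((oneSubEquiv ρ : ZetaZeros.riemannZetaNontrivialZeros) : ℂ) = 1 - (ρ : ℂ) := rfl

/-- `m(1 − ρ) = m(ρ)` (functional equation and conjugation). [folklore] -/
private theorem order_oneSubZero (ρ : ZetaZeros.riemannZetaNontrivialZeros) :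
    riemannZetaZeroOrder ((oneSubZero ρ : ZetaZeros.riemannZetaNontrivialZeros) : ℂ) =
      riemannZetaZeroOrder (ρ : ℂ) := by
  have h1 := FordL33.order_refl (conjZero ρ)
  rw [order_conjZero] at h1
  rw [← h1]
  congr 1
  simp [oneSubZero, FordL33.refl, conjZero]

/-- `m(1 − ρ) = m(ρ)`: multiplicities of the non-trivial zeros are invariant under `ρ ↦ 1 − ρ`
(functional equation; tree `riemannZetaZeroOrder_one_sub_conj` with `riemannZetaZeroOrder_conj_holds`).
[cite: Titchmarsh1986, §2.12] -/
theorem order_one_sub (ρ : ZetaZeros.riemannZetaNontrivialZeros) :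
    riemannZetaZeroOrder (1 - (ρ : ℂ)) = riemannZetaZeroOrder (ρ : ℂ) :=
  order_oneSubZero ρ

/-- `m(ρ̄) = m(ρ)` on the zero subtype (tree `riemannZetaZeroOrder_conj_holds`). [cite: Titchmarsh1986, §2.12] -/
theorem order_conj (ρ : ZetaZeros.riemannZetaNontrivialZeros) :
    riemannZetaZeroOrder (conj (ρ : ℂ)) = riemannZetaZeroOrder (ρ : ℂ) :=
  riemannZetaZeroOrder_conj_holds ρ

/-- `|1 − ρ| > 14`. [folklore] -/
private theorem fourteen_lt_norm_one_sub (ρ : ZetaZeros.riemannZetaNontrivialZeros) :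
    14 < ‖1 - (ρ : ℂ)‖ := by
  have h := FordL33.fourteen_lt_norm (oneSubZero ρ)
  rwa [coe_oneSubZero] at h

/-- `Σ_ρ m(ρ)/|1 − ρ|² < ∞` (transport of Ford's `Σ m(ρ)/|ρ|² < ∞` along `ρ ↦ 1 − ρ`). [folklore] -/
private theorem summable_order_div_norm_one_sub_sq :
    Summable fun ρ : ZetaZeros.riemannZetaNontrivialZeros ↦
      (riemannZetaZeroOrder (ρ : ℂ) : ℝ) / ‖1 - (ρ : ℂ)‖ ^ 2 := by
  have h := (oneSubEquiv.summable_iff (f := fun ρ : ZetaZeros.riemannZetaNontrivialZeros ↦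
    (riemannZetaZeroOrder (ρ : ℂ) : ℝ) / ‖(ρ : ℂ)‖ ^ 2)).2 FordL33.summable_order_div_norm_sq
  refine h.congr fun ρ ↦ ?_
  show (riemannZetaZeroOrder ((oneSubEquiv ρ : ZetaZeros.riemannZetaNontrivialZeros) : ℂ) : ℝ) /
      ‖((oneSubEquiv ρ : ZetaZeros.riemannZetaNontrivialZeros) : ℂ)‖ ^ 2 = _
  rw [show ((oneSubEquiv ρ : ZetaZeros.riemannZetaNontrivialZeros) : ℂ) = 1 - (ρ : ℂ) from rfl,
    order_one_sub]

/-! ### Growth of the Li test functions on the zeros and absolute convergence -/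

/-- `|1 − (1 − 1/s)ⁿ| ≤ n·2ⁿ/|s|` for `|s| ≥ 1` (the `O(1/|s|)` vanishing at `∞` of the Li class,
p0013:L6–7, in crude explicit form). [folklore] -/
private theorem norm_one_sub_one_sub_inv_pow_le {s : ℂ} (hs : 1 ≤ ‖s‖) (n : ℕ) :
    ‖1 - (1 - 1 / s) ^ n‖ ≤ n * 2 ^ n / ‖s‖ := by
  have hs0 : s ≠ 0 := by
    intro h; rw [h, norm_zero] at hs; exact absurd hs (by norm_num)
  have hspos : 0 < ‖s‖ := norm_pos_iff.mpr hs0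
  have hw : ‖1 - 1 / s‖ ≤ 2 := by
    calc ‖1 - 1 / s‖ ≤ ‖(1 : ℂ)‖ + ‖1 / s‖ := norm_sub_le _ _
      _ ≤ 1 + 1 := by
          rw [norm_one, norm_div, norm_one]
          gcongr
          exact (div_le_one hspos).mpr hs
      _ = 2 := by norm_num
  have key : 1 - (1 - 1 / s) ^ n = 1 / s * ∑ i ∈ Finset.range n, (1 - 1 / s) ^ i := by
    have := geom_sum_mul (1 - 1 / s) n
    linear_combination this
  rw [key, norm_mul, norm_div, norm_one, one_div_mul_eq_div]
  gcongr
  calc ‖∑ i ∈ Finset.range n, (1 - 1 / s) ^ i‖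
      ≤ ∑ i ∈ Finset.range n, ‖(1 - 1 / s) ^ i‖ := norm_sum_le _ _
    _ ≤ ∑ _i ∈ Finset.range n, (2 : ℝ) ^ n := Finset.sum_le_sum fun i hi ↦ by
        rw [norm_pow]
        exact (pow_le_pow_left₀ (norm_nonneg _) hw i).trans
          (pow_le_pow_right₀ (by norm_num) (Finset.mem_range.1 hi).le)
    _ = n * 2 ^ n := by simp

/-- **Growth bound of the Li test functions on the critical strip's zeros**: for every `k ∈ ℤ` there is
`C ≥ 0` with `|G_k(ρ)| ≤ C (1/|ρ| + 1/|1 − ρ|)` at every non-trivial zero (`G_k` for `k ≥ 0` has its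
pole at `0`, for `k < 0` at `1`; "the vanishing condition at `∞` implies a bound `F(s) = O(1/|s|)`",
p0013:L6–7). [cite: Lagarias2007LiCoefficients, §3 (arXiv p0013:L6–7)] -/
theorem exists_norm_liTestFun_le (k : ℤ) :
    ∃ C : ℝ, 0 ≤ C ∧ ∀ ρ : ZetaZeros.riemannZetaNontrivialZeros,
      ‖liTestFun k ρ‖ ≤ C * (‖(ρ : ℂ)‖⁻¹ + ‖1 - (ρ : ℂ)‖⁻¹) := by
  obtain ⟨n, rfl | rfl⟩ := k.eq_nat_or_neg
  · refine ⟨n * 2 ^ n, by positivity, fun ρ ↦ ?_⟩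
    have h1 : 1 ≤ ‖(ρ : ℂ)‖ := by linarith [FordL33.fourteen_lt_norm ρ]
    rw [liTestFun_natCast]
    calc ‖1 - (1 - 1 / (ρ : ℂ)) ^ n‖ ≤ n * 2 ^ n / ‖(ρ : ℂ)‖ := norm_one_sub_one_sub_inv_pow_le h1 n
      _ = n * 2 ^ n * ‖(ρ : ℂ)‖⁻¹ := by rw [div_eq_mul_inv]
      _ ≤ n * 2 ^ n * (‖(ρ : ℂ)‖⁻¹ + ‖1 - (ρ : ℂ)‖⁻¹) := by
          gcongr
          exact le_add_of_nonneg_right (inv_nonneg.2 (norm_nonneg _))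
  · refine ⟨n * 2 ^ n, by positivity, fun ρ ↦ ?_⟩
    have h1 : 1 ≤ ‖1 - (ρ : ℂ)‖ := by linarith [fourteen_lt_norm_one_sub ρ]
    rw [liTestFun_neg (coe_ne_zero ρ) (coe_ne_one ρ), liTestFun_natCast]
    calc ‖1 - (1 - 1 / (1 - (ρ : ℂ))) ^ n‖ ≤ n * 2 ^ n / ‖1 - (ρ : ℂ)‖ :=
          norm_one_sub_one_sub_inv_pow_le h1 n
      _ = n * 2 ^ n * ‖1 - (ρ : ℂ)‖⁻¹ := by rw [div_eq_mul_inv]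
      _ ≤ n * 2 ^ n * (‖(ρ : ℂ)‖⁻¹ + ‖1 - (ρ : ℂ)‖⁻¹) := by
          gcongr
          exact le_add_of_nonneg_left (inv_nonneg.2 (norm_nonneg _))

/-- **Absolute convergence of `⟨G_n, G_m⟩_W`** (p0012:L27–28 "converges absolutely due to the growth
bound"): the family `m(ρ) G_n(ρ) conj G_m(1−ρ̄)` is summable over the zeros, being
`O(m(ρ)(1/|ρ| + 1/|1−ρ|)²)`. [cite: Lagarias2007LiCoefficients, §3 (arXiv p0012:L27–28)] -/
theorem summable_liWeilPairing_term (n m : ℤ) :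
    Summable fun ρ : ZetaZeros.riemannZetaNontrivialZeros ↦
      (riemannZetaZeroOrder (ρ : ℂ) : ℂ) * (liTestFun n ρ * conj (liTestFun m (1 - conj (ρ : ℂ)))) := by
  obtain ⟨C₁, hC₁, h₁⟩ := exists_norm_liTestFun_le n
  obtain ⟨C₂, hC₂, h₂⟩ := exists_norm_liTestFun_le m
  have hS : Summable fun ρ : ZetaZeros.riemannZetaNontrivialZeros ↦
      2 * C₁ * C₂ * ((riemannZetaZeroOrder (ρ : ℂ) : ℝ) / ‖(ρ : ℂ)‖ ^ 2 +
        (riemannZetaZeroOrder (ρ : ℂ) : ℝ) / ‖1 - (ρ : ℂ)‖ ^ 2) :=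
    (FordL33.summable_order_div_norm_sq.add summable_order_div_norm_one_sub_sq).mul_left _
  refine Summable.of_norm_bounded hS fun ρ ↦ ?_
  have hm : (0 : ℝ) < riemannZetaZeroOrder (ρ : ℂ) := FordL33.order_pos ρ
  -- `G_m` at `1 − ρ̄`: the bound is symmetric
  have h₂' : ‖liTestFun m (1 - conj (ρ : ℂ))‖ ≤ C₂ * (‖(ρ : ℂ)‖⁻¹ + ‖1 - (ρ : ℂ)‖⁻¹) := by
    have h := h₂ (FordL33.refl ρ)
    have e1 : ((FordL33.refl ρ : ZetaZeros.riemannZetaNontrivialZeros) : ℂ) = 1 - conj (ρ : ℂ) := rfl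
    have e2 : ‖1 - conj (ρ : ℂ)‖ = ‖1 - (ρ : ℂ)‖ := by
      rw [show (1 : ℂ) - conj (ρ : ℂ) = conj (1 - (ρ : ℂ)) by simp, Complex.norm_conj]
    have e3 : ‖1 - (1 - conj (ρ : ℂ))‖ = ‖(ρ : ℂ)‖ := by rw [sub_sub_cancel, Complex.norm_conj]
    rw [e1, e2, e3, add_comm] at h
    exact h
  set u : ℝ := ‖(ρ : ℂ)‖⁻¹ with hu
  set v : ℝ := ‖1 - (ρ : ℂ)‖⁻¹ with hv
  have hu0 : 0 ≤ u := inv_nonneg.2 (norm_nonneg _)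
  have hv0 : 0 ≤ v := inv_nonneg.2 (norm_nonneg _)
  rw [norm_mul, Complex.norm_intCast, abs_of_pos hm, norm_mul, Complex.norm_conj]
  have hsq : (u + v) ^ 2 ≤ 2 * (u ^ 2 + v ^ 2) := by nlinarith [sq_nonneg (u - v)]
  calc (riemannZetaZeroOrder (ρ : ℂ) : ℝ) * (‖liTestFun n ρ‖ * ‖liTestFun m (1 - conj (ρ : ℂ))‖)
      ≤ (riemannZetaZeroOrder (ρ : ℂ) : ℝ) * ((C₁ * (u + v)) * (C₂ * (u + v))) := by
        refine mul_le_mul_of_nonneg_left ?_ hm.le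
        exact mul_le_mul (h₁ ρ) h₂' (norm_nonneg _) (mul_nonneg hC₁ (add_nonneg hu0 hv0))
    _ = (riemannZetaZeroOrder (ρ : ℂ) : ℝ) * (C₁ * C₂) * (u + v) ^ 2 := by ring
    _ ≤ (riemannZetaZeroOrder (ρ : ℂ) : ℝ) * (C₁ * C₂) * (2 * (u ^ 2 + v ^ 2)) :=
        mul_le_mul_of_nonneg_left hsq (by positivity)
    _ = 2 * C₁ * C₂ * ((riemannZetaZeroOrder (ρ : ℂ) : ℝ) / ‖(ρ : ℂ)‖ ^ 2 +
          (riemannZetaZeroOrder (ρ : ℂ) : ℝ) / ‖1 - (ρ : ℂ)‖ ^ 2) := by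
        rw [hu, hv, inv_pow, inv_pow, div_eq_mul_inv, div_eq_mul_inv]; ring

/-- Summability of `m(ρ) Re G_k(ρ)` over the zeros for every `k ∈ ℤ` (`k ≥ 1`: the tree's
`summable_keiperLiTerm`; `k ≤ −1`: transport along `ρ ↦ 1 − ρ` by (3.5); `k = 0`: zero).
[cite: Lagarias2007LiCoefficients, §1 eq. (1.7) (arXiv p0002:L50–57, convergence of the λ_n)] -/
theorem summable_order_mul_re_liTestFun (k : ℤ) :
    Summable fun ρ : ZetaZeros.riemannZetaNontrivialZeros ↦
      (riemannZetaZeroOrder (ρ : ℂ) : ℝ) * (liTestFun k ρ).re := by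
  obtain ⟨n, rfl | rfl⟩ := k.eq_nat_or_neg
  · refine (summable_keiperLiTerm n).congr fun ρ ↦ ?_
    rw [liTestFun_natCast]
  · have h := (oneSubEquiv.summable_iff (f := fun ρ : ZetaZeros.riemannZetaNontrivialZeros ↦
      (riemannZetaZeroOrder (ρ : ℂ) : ℝ) * (liTestFun n ρ).re)).2
      ((summable_keiperLiTerm n).congr fun ρ ↦ by rw [liTestFun_natCast])
    refine h.congr fun ρ ↦ ?_
    simp only [Function.comp_apply]
    rw [show ((oneSubEquiv ρ : ZetaZeros.riemannZetaNontrivialZeros) : ℂ) = 1 - (ρ : ℂ) from rfl,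
      order_one_sub, liTestFun_neg (coe_ne_zero ρ) (coe_ne_one ρ)]

end LiWeil

open LiWeil

/-! ### `λ_n` for `n ∈ ℤ`: the tree's `λ_n` for `n ≥ 1`, `λ_{−n} = λ_n`, `λ_0 = 0` -/

/-- `λ_0 = 0` (`G_0 ≡ 0`). [cite: Lagarias2007LiCoefficients, §1 eq. (1.7) (arXiv p0002)] -/
@[simp] theorem liCoeffZ_zero : liCoeffZ 0 = 0 := by
  simp [liCoeffZ]

/-- For `n ≥ 1`, `λ_n` of (1.7) is the tree's Keiper–Li coefficient (`keiperLiCoeff_eq_tsum_zeros`).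
[cite: Lagarias2007LiCoefficients, §1 eq. (1.7) (arXiv p0002:L50)] -/
theorem liCoeffZ_natCast {n : ℕ} (hn : 1 ≤ n) : liCoeffZ n = keiperLiCoeff n := by
  rw [keiperLiCoeff_eq_tsum_zeros hn, liCoeffZ]
  refine tsum_congr fun ρ ↦ ?_
  rw [liTestFun_natCast]

/-- **`λ_{−n} = λ_n` for `ζ`**: by (3.5) `G_{−n}(ρ) = G_n(1 − ρ)` and the zero multiset of `ζ` is
invariant under `ρ ↦ 1 − ρ` with `m(1−ρ) = m(ρ)` (for a general `π`, `λ_{−n}(π) = conj λ_n(π^∨)`,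
p0002). [cite: Lagarias2007LiCoefficients, §3 eq. (3.5) and Thm 3.1 eq. (3.4) (arXiv p0013:L17–19)] -/
theorem liCoeffZ_neg (n : ℤ) : liCoeffZ (-n) = liCoeffZ n := by
  unfold liCoeffZ
  rw [← oneSubEquiv.tsum_eq (fun ρ : ZetaZeros.riemannZetaNontrivialZeros ↦
    (riemannZetaZeroOrder (ρ : ℂ) : ℝ) * (liTestFun n ρ).re)]
  refine tsum_congr fun ρ ↦ ?_
  rw [show ((oneSubEquiv ρ : ZetaZeros.riemannZetaNontrivialZeros) : ℂ) = 1 - (ρ : ℂ) from rfl,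
    order_one_sub, liTestFun_neg (coe_ne_zero ρ) (coe_ne_one ρ)]

/-! ## Theorem 3.1: the Weil scalar product on the Li basis -/

/-- **Lagarias 2007, Theorem 3.1** (p0013:L14–19), case `π = ζ` — NAMED STATEMENT AS PRINTED: "For the
Li test functions `G_n(s) = 1 − (1 − 1/s)ⁿ` there holds `⟨G_n, G_m⟩_W = λ_n + λ_{−m} − λ_{n−m}` (3.3).
In particular `‖G_n‖²_W = λ_n + λ_{−n} = 2 Re(λ_n)` (3.4)."  (For `ζ` the `λ_n` are real.)
PROVED below (`Lagarias2007_thm31_zeta_holds`). [cite: Lagarias2007LiCoefficients, Theorem 3.1] -/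
def Lagarias2007_thm31_zeta : Prop :=
  (∀ n m : ℤ, liWeilPairing (liTestFun n) (liTestFun m) =
      ((liCoeffZ n + liCoeffZ (-m) - liCoeffZ (n - m) : ℝ) : ℂ)) ∧
    ∀ n : ℤ, liWeilPairing (liTestFun n) (liTestFun n) = ((2 * liCoeffZ n : ℝ) : ℂ)

/-- The `ρ`-th term of `⟨G_n, G_m⟩_W` is `m(ρ)[G_n(ρ) + G_{−m}(ρ) − G_{n−m}(ρ)]` — the printed chain
`conj G_m(1−ρ̄) = G_m(1−ρ) = G_{−m}(ρ)` (reflection, (3.5)) and (3.6).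
[cite: Lagarias2007LiCoefficients, §3 proof of Thm 3.1 (arXiv p0013:L20–33)] -/
theorem liWeilPairing_term_liTestFun (n m : ℤ) (ρ : ZetaZeros.riemannZetaNontrivialZeros) :
    (riemannZetaZeroOrder (ρ : ℂ) : ℂ) * (liTestFun n ρ * conj (liTestFun m (1 - conj (ρ : ℂ)))) =
      (riemannZetaZeroOrder (ρ : ℂ) : ℂ) *
        (liTestFun n ρ + liTestFun (-m) ρ - liTestFun (n - m) ρ) := by
  have hrefl : conj (liTestFun m (1 - conj (ρ : ℂ))) = liTestFun m (1 - (ρ : ℂ)) := by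
    rw [conj_liTestFun, map_sub, map_one, Complex.conj_conj]
  rw [hrefl, ← liTestFun_neg (coe_ne_zero ρ) (coe_ne_one ρ) m,
    liTestFun_mul_neg (coe_ne_zero ρ) (coe_ne_one ρ)]

/-- **Lagarias 2007, Theorem 3.1, eq. (3.3)** for `ζ` — PROVED: `⟨G_n, G_m⟩_W = λ_n + λ_{−m} − λ_{n−m}`
(`n, m ∈ ℤ`).  The sum of the terms `m(ρ)[G_n + G_{−m} − G_{n−m}](ρ)` is real (conjugation symmetry of
the zeros) and its real part splits into the three absolutely convergent sums `λ_n`, `λ_{−m}`, `λ_{n−m}`.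
[cite: Lagarias2007LiCoefficients, Theorem 3.1 eq. (3.3)] -/
theorem liWeilPairing_liTestFun (n m : ℤ) :
    liWeilPairing (liTestFun n) (liTestFun m) =
      ((liCoeffZ n + liCoeffZ (-m) - liCoeffZ (n - m) : ℝ) : ℂ) := by
  -- the termwise identity
  set T : ZetaZeros.riemannZetaNontrivialZeros → ℂ := fun ρ ↦
    (riemannZetaZeroOrder (ρ : ℂ) : ℂ) * (liTestFun n ρ + liTestFun (-m) ρ - liTestFun (n - m) ρ)
    with hT
  have hterm : ∀ ρ : ZetaZeros.riemannZetaNontrivialZeros,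
      (riemannZetaZeroOrder (ρ : ℂ) : ℂ) * (liTestFun n ρ * conj (liTestFun m (1 - conj (ρ : ℂ)))) =
        T ρ := fun ρ ↦ liWeilPairing_term_liTestFun n m ρ
  have hS : Summable T := (summable_liWeilPairing_term n m).congr hterm
  have hsum : liWeilPairing (liTestFun n) (liTestFun m) = ∑' ρ, T ρ := by
    unfold liWeilPairing
    exact tsum_congr hterm
  -- the sum is real: invariant under `ρ ↦ ρ̄`
  have hconj : ∀ ρ : ZetaZeros.riemannZetaNontrivialZeros, conj (T ρ) = T (conjEquiv ρ) := by
    intro ρ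
    simp only [hT, map_mul, map_intCast, map_sub, map_add, conj_liTestFun, coe_conjEquiv]
    rw [order_conj]
  have hreal : (∑' ρ, T ρ).im = 0 := by
    rw [← Complex.conj_eq_iff_im, Complex.conj_tsum]
    simp_rw [hconj]
    exact conjEquiv.tsum_eq T
  -- real parts
  have hre : (∑' ρ, T ρ).re = liCoeffZ n + liCoeffZ (-m) - liCoeffZ (n - m) := by
    rw [Complex.re_tsum hS]
    have e : ∀ ρ : ZetaZeros.riemannZetaNontrivialZeros, (T ρ).re =
        (riemannZetaZeroOrder (ρ : ℂ) : ℝ) * (liTestFun n ρ).re +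
          (riemannZetaZeroOrder (ρ : ℂ) : ℝ) * (liTestFun (-m) ρ).re -
          (riemannZetaZeroOrder (ρ : ℂ) : ℝ) * (liTestFun (n - m) ρ).re := by
      intro ρ
      simp only [hT, Complex.mul_re, Complex.intCast_re, Complex.intCast_im, zero_mul, sub_zero,
        Complex.add_re, Complex.sub_re]
      ring
    rw [tsum_congr e, ((summable_order_mul_re_liTestFun n).add
      (summable_order_mul_re_liTestFun (-m))).tsum_sub (summable_order_mul_re_liTestFun (n - m)),
      (summable_order_mul_re_liTestFun n).tsum_add (summable_order_mul_re_liTestFun (-m))]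
    rfl
  rw [hsum]
  apply Complex.ext
  · rw [hre, Complex.ofReal_re]
  · rw [hreal, Complex.ofReal_im]

/-- **Lagarias 2007, Theorem 3.1, eq. (3.4)** for `ζ` — PROVED: `‖G_n‖²_W = λ_n + λ_{−n} = 2λ_n`
(`= 2 Re λ_n`; `λ_{−n} = λ_n`, `λ_0 = 0`). [cite: Lagarias2007LiCoefficients, Theorem 3.1 eq. (3.4)] -/
theorem liWeilPairing_liTestFun_self (n : ℤ) :
    liWeilPairing (liTestFun n) (liTestFun n) = ((2 * liCoeffZ n : ℝ) : ℂ) := by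
  rw [liWeilPairing_liTestFun, sub_self, liCoeffZ_zero, liCoeffZ_neg]
  congr 1
  ring

/-- **Lagarias 2007, Theorem 3.1** for `ζ` — DISCHARGED. [cite: Lagarias2007LiCoefficients, Theorem 3.1] -/
theorem Lagarias2007_thm31_zeta_holds : Lagarias2007_thm31_zeta :=
  ⟨liWeilPairing_liTestFun, liWeilPairing_liTestFun_self⟩

/-- For `n ≥ 1`: `‖G_n‖²_W = 2 λ_n` with the tree's `λ_n = keiperLiCoeff n`.
[cite: Lagarias2007LiCoefficients, Theorem 3.1 eq. (3.4)] -/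
theorem liWeilPairing_liTestFun_self_natCast {n : ℕ} (hn : 1 ≤ n) :
    liWeilPairing (liTestFun n) (liTestFun n) = ((2 * keiperLiCoeff n : ℝ) : ℂ) := by
  rw [liWeilPairing_liTestFun_self, liCoeffZ_natCast hn]

/-! ## The printed remarks: positivity of the Weil scalar product on the Li class and RH -/

/-- Under RH, `1 − ρ̄ = ρ` for every non-trivial zero. [folklore] -/
private theorem one_sub_conj_eq_self_of_riemannHypothesis (hRH : RiemannHypothesis)
    (ρ : ZetaZeros.riemannZetaNontrivialZeros) : 1 - conj (ρ : ℂ) = ρ := by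
  have hζ := riemannZetaNontrivialZeros.zeta_eq_zero ρ.2
  have h0 := riemannZetaNontrivialZeros.re_pos ρ.2
  have hre : (ρ : ℂ).re = 1 / 2 := by
    refine hRH ρ hζ ?_ (riemannZetaNontrivialZeros.ne_one ρ.2)
    rintro ⟨k, hk⟩
    have : (ρ : ℂ).re = -2 * (k + 1) := by rw [hk]; simp [mul_re]
    have hk0 : (0 : ℝ) ≤ k := k.cast_nonneg
    linarith
  apply Complex.ext
  · simp [hre]; norm_num
  · simp

/-- **Remark (p0012:L38–45), RH-CONSEQUENCE (explicit binder):** "The Riemann hypothesis implies that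
for all `F`, `⟨F,F⟩_W = Σ_ρ F(ρ) conj F(1−ρ̄) = Σ_ρ |F(ρ)|² ≥ 0`" — under RH `1 − ρ̄ = ρ`, so the Weil
scalar product is the (multiplicity-weighted) sum of `|F(ρ)|²`.  Typed for every `F : ℂ → ℂ` (the
identity is termwise; the class `A` only guarantees convergence).
[cite: Lagarias2007LiCoefficients, §3 remark (arXiv p0012:L38–45)] -/
theorem liWeilPairing_self_eq_of_riemannHypothesis (hRH : RiemannHypothesis) (F : ℂ → ℂ) :
    liWeilPairing F F = ((∑' ρ : ZetaZeros.riemannZetaNontrivialZeros,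
      (riemannZetaZeroOrder (ρ : ℂ) : ℝ) * ‖F ρ‖ ^ 2 : ℝ) : ℂ) := by
  unfold liWeilPairing
  rw [Complex.ofReal_tsum]
  refine tsum_congr fun ρ ↦ ?_
  rw [one_sub_conj_eq_self_of_riemannHypothesis hRH ρ, Complex.mul_conj, Complex.normSq_eq_norm_sq]
  push_cast
  ring

/-- **Remark (p0012:L38–45), RH-CONSEQUENCE:** under RH the Weil scalar product is positive
semidefinite: `Re ⟨F,F⟩_W ≥ 0` (and `⟨F,F⟩_W` is real).
[cite: Lagarias2007LiCoefficients, §3 remark (arXiv p0012:L38–45)] -/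
theorem liWeilPairing_self_nonneg_of_riemannHypothesis (hRH : RiemannHypothesis) (F : ℂ → ℂ) :
    0 ≤ (liWeilPairing F F).re := by
  rw [liWeilPairing_self_eq_of_riemannHypothesis hRH F, Complex.ofReal_re]
  exact tsum_nonneg fun ρ ↦ mul_nonneg (FordL33.order_pos ρ).le (sq_nonneg _)

/-- **Remark (p0013:L64–66), RH-FREE door:** "The Li class `L` is large enough to characterize the
Riemann hypothesis in terms of the semidefiniteness of the Weil scalar product. Theorem 3.1 shows that
semidefiniteness implies that all `Re(λ_n) ≥ 0`. The Riemann hypothesis then follows from Theorem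
2.2(2)" (Li's criterion; tree `li_criterion_holds`).  It suffices to have `⟨G_n, G_n⟩_W ≥ 0` for the
`G_n`, `n ≥ 1`. [cite: Lagarias2007LiCoefficients, §3 remark after Thm 3.1 (arXiv p0013:L64–66)] -/
theorem riemannHypothesis_of_liWeilPairing_self_nonneg
    (h : ∀ n : ℤ, 1 ≤ n → 0 ≤ (liWeilPairing (liTestFun n) (liTestFun n)).re) : RiemannHypothesis := by
  refine li_criterion_holds.2 fun n hn ↦ ?_
  have h1 := h (n : ℤ) (by exact_mod_cast hn)
  rw [liWeilPairing_liTestFun_self_natCast hn, Complex.ofReal_re] at h1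
  linarith

/-- **RH-EQUIVALENT·PRINTED (l.1)** — the two remarks together ([La07] p0012:L38–45 and p0013:L64–66):
RH holds iff the Weil scalar product is positive semidefinite on the Li basis, `⟨G_n,G_n⟩_W ≥ 0` for
all `n ≥ 1`.  This is Weil's criterion restricted to the Li class = Li's criterion re-read; neither side
is asserted. [cite: Lagarias2007LiCoefficients, §3 remarks (arXiv p0012:L38–45, p0013:L64–66)] -/
theorem riemannHypothesis_iff_liWeilPairing_self_nonneg :
    RiemannHypothesis ↔ ∀ n : ℤ, 1 ≤ n → 0 ≤ (liWeilPairing (liTestFun n) (liTestFun n)).re :=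
  ⟨fun hRH _ _ ↦ liWeilPairing_self_nonneg_of_riemannHypothesis hRH _,
    riemannHypothesis_of_liWeilPairing_self_nonneg⟩

/-- **Remark (p0014:L1–6), RH-CONSEQUENCE (explicit binder):** "If the Riemann hypothesis holds, then
the Weil scalar product is positive definite on `L`.  For if `F ∈ L` is nonzero, then since it is a
rational function it has finitely many zeros, so cannot vanish at all points of `Z(π)`. Thus
`‖F‖²_W = Σ_ρ |F(ρ)|² > 0`."  Typed for `F(s) = P(s)/(s^a (1−s)^b)` with `P ≠ 0` a polynomial (every
element of `L` has this shape) and the absolute convergence of `‖F‖²_W` as an explicit hypothesis;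
"cannot vanish at all zeros" uses that `ζ` has infinitely many non-trivial zeros (Hardy, tree
`hardy_infinite_zeros_on_critical_line_holds`). [cite: Lagarias2007LiCoefficients, §3 remark (arXiv p0014:L1–6)] -/
theorem liWeilPairing_self_pos_of_riemannHypothesis (hRH : RiemannHypothesis) (P : Polynomial ℂ)
    (hP : P ≠ 0) (a b : ℕ)
    (hsum : Summable fun ρ : ZetaZeros.riemannZetaNontrivialZeros ↦
      (riemannZetaZeroOrder (ρ : ℂ) : ℝ) *
        ‖P.eval (ρ : ℂ) / ((ρ : ℂ) ^ a * (1 - (ρ : ℂ)) ^ b)‖ ^ 2) :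
    0 < (liWeilPairing (fun s ↦ P.eval s / (s ^ a * (1 - s) ^ b))
      (fun s ↦ P.eval s / (s ^ a * (1 - s) ^ b))).re := by
  classical
  rw [liWeilPairing_self_eq_of_riemannHypothesis hRH, Complex.ofReal_re]
  -- a zero `ρ₀` of `ζ` which is not a root of `P`
  obtain ⟨ρ₀, hρ₀⟩ : ∃ ρ₀ : ZetaZeros.riemannZetaNontrivialZeros, P.eval (ρ₀ : ℂ) ≠ 0 := by
    by_contra hall
    push Not at hall
    -- then every critical zero `1/2 + it` is a root of `P`: finitely many `t`
    have hfin : {t : ℝ | riemannZeta (1 / 2 + t * I) = 0}.Finite := by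
      have hroots : (P.roots.toFinset : Set ℂ).Finite := Finset.finite_toSet _
      refine (hroots.preimage (f := fun t : ℝ ↦ (1 / 2 + t * I : ℂ)) fun t₁ _ t₂ _ h ↦ ?_).subset ?_
      · have := congrArg Complex.im h
        simpa using this
      · intro t ht
        have hmem : (1 / 2 + t * I : ℂ) ∈ ZetaZeros.riemannZetaNontrivialZeros :=
          riemannZetaNontrivialZeros.mem_iff'.2 ⟨ht, by simp, by norm_num⟩
        have h0 := hall ⟨_, hmem⟩
        simp only [Set.mem_preimage, Finset.mem_coe, Multiset.mem_toFinset]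
        exact (Polynomial.mem_roots hP).2 h0
    exact hardy_infinite_zeros_on_critical_line_holds hfin
  have hterm : ∀ ρ : ZetaZeros.riemannZetaNontrivialZeros,
      0 ≤ (riemannZetaZeroOrder (ρ : ℂ) : ℝ) *
        ‖P.eval (ρ : ℂ) / ((ρ : ℂ) ^ a * (1 - (ρ : ℂ)) ^ b)‖ ^ 2 :=
    fun ρ ↦ mul_nonneg (FordL33.order_pos ρ).le (sq_nonneg _)
  refine hsum.tsum_pos hterm ρ₀ (mul_pos (FordL33.order_pos ρ₀) (pow_pos (norm_pos_iff.2 ?_) 2))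
  have hden : (ρ₀ : ℂ) ^ a * (1 - (ρ₀ : ℂ)) ^ b ≠ 0 :=
    mul_ne_zero (pow_ne_zero _ (coe_ne_zero ρ₀)) (pow_ne_zero _ (sub_ne_zero.2 (coe_ne_one ρ₀).symm))
  exact div_ne_zero hρ₀ hden

/-! ### Positive definiteness on the Li class `L` itself (p0014:L1–6), no convergence hypothesis -/

namespace LiWeil

/-- The non-trivial zeros of `ζ` are unbounded: for every `R` there is one with `|ρ| > R` (Hardy's
infinitely many critical zeros, tree `hardy_infinite_zeros_on_critical_line_holds`, and local
finiteness of the zero set). [cite: Titchmarsh1986, §10.1] -/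
theorem exists_lt_norm_zero (R : ℝ) :
    ∃ ρ : ZetaZeros.riemannZetaNontrivialZeros, R < ‖(ρ : ℂ)‖ := by
  by_contra h
  push Not at h
  -- all zeros lie in the ball of radius `|R| + 1`: finitely many, so finitely many critical ordinates
  have hfin : (ZetaZeros.riemannZetaNontrivialZeros ∩ Metric.ball (0 : ℂ) (|R| + 1)).Finite :=
    riemannZetaNontrivialZeros_finite_inter_ball 0 _
  have hsub : (fun t : ℝ ↦ (1 / 2 + t * I : ℂ)) '' {t : ℝ | riemannZeta (1 / 2 + t * I) = 0} ⊆
      ZetaZeros.riemannZetaNontrivialZeros ∩ Metric.ball (0 : ℂ) (|R| + 1) := by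
    rintro _ ⟨t, ht, rfl⟩
    have hmem : (1 / 2 + t * I : ℂ) ∈ ZetaZeros.riemannZetaNontrivialZeros :=
      riemannZetaNontrivialZeros.mem_iff'.2 ⟨ht, by simp, by norm_num⟩
    refine ⟨hmem, ?_⟩
    rw [Metric.mem_ball, dist_zero_right]
    linarith [h ⟨_, hmem⟩, le_abs_self R]
  have hinj : Set.InjOn (fun t : ℝ ↦ (1 / 2 + t * I : ℂ)) {t : ℝ | riemannZeta (1 / 2 + t * I) = 0} :=
    fun t₁ _ t₂ _ h ↦ by simpa using congrArg Complex.im h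
  exact hardy_infinite_zeros_on_critical_line_holds
    ((hfin.subset hsub).of_finite_image hinj)

/-- A function of the Li class `L = span{G_n}`: `F = Σ_{n ∈ S} c_n G_n`, read at `w = 1/s`:
`F(s) = H(1/s)` with `H(w) = Σ c_n (1 − (1 − w)ⁿ)` ("vanishing at `∞`", p0013:L6–9). [folklore] -/
private theorem liClass_eq_comp_inv (S : Finset ℤ) (c : ℤ → ℂ) (s : ℂ) :
    ∑ n ∈ S, c n * liTestFun n s = ∑ n ∈ S, c n * (1 - (1 - s⁻¹) ^ n) := by
  simp [liTestFun, one_div]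

/-- `H(w) = Σ c_n (1 − (1 − w)ⁿ)` is analytic off `w = 1`. [folklore] -/
private theorem analyticAt_liClassInv (S : Finset ℤ) (c : ℤ → ℂ) {w : ℂ} (hw : w ≠ 1) :
    AnalyticAt ℂ (fun w ↦ ∑ n ∈ S, c n * (1 - (1 - w) ^ n)) w := by
  refine Finset.analyticAt_fun_sum S fun n _ ↦ analyticAt_const.mul (analyticAt_const.sub ?_)
  exact (analyticAt_const.sub analyticAt_id).fun_zpow (sub_ne_zero.2 (Ne.symm hw))

/-- **A nonzero `F ∈ L` does not vanish at all non-trivial zeros** (p0014:L3–5: "since it is a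
rational function it has finitely many zeros, so cannot vanish at all points of `Z(π)`").  Here:
`H(w) = F(1/w)` is analytic at `w = 0` with `H(0) = 0`; if `F` vanished at all zeros, `H` would
vanish on `1/ρ → 0`, hence near `0`, hence on the connected set `ℂ ∖ {1}` — so `F ≡ 0` off
`{0, 1}`. [cite: Lagarias2007LiCoefficients, §3 remark (arXiv p0014:L1–6)] -/
theorem exists_zero_liClass_ne_zero (S : Finset ℤ) (c : ℤ → ℂ)
    (hF : ∃ s : ℂ, s ≠ 0 ∧ s ≠ 1 ∧ ∑ n ∈ S, c n * liTestFun n s ≠ 0) :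
    ∃ ρ : ZetaZeros.riemannZetaNontrivialZeros, ∑ n ∈ S, c n * liTestFun n ρ ≠ 0 := by
  by_contra hall
  push Not at hall
  set H : ℂ → ℂ := fun w ↦ ∑ n ∈ S, c n * (1 - (1 - w) ^ n) with hH
  have hFH : ∀ s : ℂ, ∑ n ∈ S, c n * liTestFun n s = H s⁻¹ := fun s ↦ by
    rw [hH, liClass_eq_comp_inv]
  -- `H` vanishes frequently near `0` (at the points `1/ρ`)
  have hfreq : ∃ᶠ w in 𝓝[≠] (0 : ℂ), H w = 0 := by
    rw [(Metric.nhdsWithin_basis_ball (s := ({0}ᶜ : Set ℂ)) (x := (0 : ℂ))).frequently_iff]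
    intro ε hε
    obtain ⟨ρ, hρ⟩ := exists_lt_norm_zero ε⁻¹
    have hρ0 : (ρ : ℂ) ≠ 0 := coe_ne_zero ρ
    refine ⟨(ρ : ℂ)⁻¹, ⟨?_, by simpa using hρ0⟩, ?_⟩
    · rw [Metric.mem_ball, dist_zero_right, norm_inv]
      have hpos : 0 < ‖(ρ : ℂ)‖ := norm_pos_iff.2 hρ0
      calc ‖(ρ : ℂ)‖⁻¹ < (ε⁻¹)⁻¹ := by
            gcongr
        _ = ε := inv_inv ε
    · rw [← hFH]; exact hall ρ
  have hH0 : AnalyticAt ℂ H 0 := analyticAt_liClassInv S c one_ne_zero.symm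
  have hev : H =ᶠ[𝓝 0] 0 := by
    refine hH0.eventually_eq_zero_or_eventually_ne_zero.resolve_right fun hne ↦ ?_
    obtain ⟨w, hw0, hw1⟩ := (hfreq.and_eventually hne).exists
    exact hw1 hw0
  -- identity theorem on the connected open set `ℂ ∖ {1}`
  have hU : IsPreconnected ({1}ᶜ : Set ℂ) :=
    (isConnected_compl_singleton_of_one_lt_rank (by simp) (1 : ℂ)).isPreconnected
  have hHan : AnalyticOnNhd ℂ H ({1}ᶜ : Set ℂ) := fun w hw ↦ analyticAt_liClassInv S c hw
  have hzero := hHan.eqOn_zero_of_preconnected_of_eventuallyEq_zero hU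
    (z₀ := 0) (by simp) hev
  obtain ⟨s₀, hs0, hs1, hne⟩ := hF
  refine hne ?_
  rw [hFH]
  exact hzero (by simpa using inv_ne_one.2 hs1)

/-- Absolute convergence of `‖F‖²_W = Σ m(ρ)|F(ρ)|²` for `F ∈ L` (from the growth bound
`exists_norm_liTestFun_le`, `|F(ρ)| ≤ K(1/|ρ| + 1/|1−ρ|)`, and `Σ m(ρ)/|ρ|² < ∞`).
[cite: Lagarias2007LiCoefficients, §3 (arXiv p0012:L27–28, p0013:L6–7)] -/
theorem summable_order_mul_norm_sq_liClass (S : Finset ℤ) (c : ℤ → ℂ) :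
    Summable fun ρ : ZetaZeros.riemannZetaNontrivialZeros ↦
      (riemannZetaZeroOrder (ρ : ℂ) : ℝ) * ‖∑ n ∈ S, c n * liTestFun n ρ‖ ^ 2 := by
  choose C hC0 hC using fun n : ℤ ↦ exists_norm_liTestFun_le n
  set K : ℝ := ∑ n ∈ S, ‖c n‖ * C n with hK
  have hK0 : 0 ≤ K := Finset.sum_nonneg fun n _ ↦ mul_nonneg (norm_nonneg _) (hC0 n)
  have hbound : ∀ ρ : ZetaZeros.riemannZetaNontrivialZeros,
      ‖∑ n ∈ S, c n * liTestFun n ρ‖ ≤ K * (‖(ρ : ℂ)‖⁻¹ + ‖1 - (ρ : ℂ)‖⁻¹) := fun ρ ↦ by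
    calc ‖∑ n ∈ S, c n * liTestFun n ρ‖ ≤ ∑ n ∈ S, ‖c n * liTestFun n ρ‖ := norm_sum_le _ _
      _ ≤ ∑ n ∈ S, ‖c n‖ * C n * (‖(ρ : ℂ)‖⁻¹ + ‖1 - (ρ : ℂ)‖⁻¹) :=
          Finset.sum_le_sum fun n _ ↦ by
            rw [norm_mul, mul_assoc]
            exact mul_le_mul_of_nonneg_left (hC n ρ) (norm_nonneg _)
      _ = K * (‖(ρ : ℂ)‖⁻¹ + ‖1 - (ρ : ℂ)‖⁻¹) := by rw [hK, Finset.sum_mul]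
  have hS : Summable fun ρ : ZetaZeros.riemannZetaNontrivialZeros ↦
      2 * K ^ 2 * ((riemannZetaZeroOrder (ρ : ℂ) : ℝ) / ‖(ρ : ℂ)‖ ^ 2 +
        (riemannZetaZeroOrder (ρ : ℂ) : ℝ) / ‖1 - (ρ : ℂ)‖ ^ 2) :=
    (FordL33.summable_order_div_norm_sq.add summable_order_div_norm_one_sub_sq).mul_left _
  refine hS.of_nonneg_of_le (fun ρ ↦ mul_nonneg (FordL33.order_pos ρ).le (sq_nonneg _)) fun ρ ↦ ?_
  have hm : (0 : ℝ) ≤ riemannZetaZeroOrder (ρ : ℂ) := (FordL33.order_pos ρ).le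
  set a : ℝ := ‖(ρ : ℂ)‖⁻¹
  set b : ℝ := ‖1 - (ρ : ℂ)‖⁻¹
  have hab : ‖∑ n ∈ S, c n * liTestFun n ρ‖ ^ 2 ≤ 2 * K ^ 2 * (a ^ 2 + b ^ 2) := by
    calc ‖∑ n ∈ S, c n * liTestFun n ρ‖ ^ 2 ≤ (K * (a + b)) ^ 2 :=
          pow_le_pow_left₀ (norm_nonneg _) (hbound ρ) 2
      _ ≤ 2 * K ^ 2 * (a ^ 2 + b ^ 2) := by nlinarith [sq_nonneg (a - b), sq_nonneg K]
  calc (riemannZetaZeroOrder (ρ : ℂ) : ℝ) * ‖∑ n ∈ S, c n * liTestFun n ρ‖ ^ 2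
      ≤ (riemannZetaZeroOrder (ρ : ℂ) : ℝ) * (2 * K ^ 2 * (a ^ 2 + b ^ 2)) :=
        mul_le_mul_of_nonneg_left hab hm
    _ = 2 * K ^ 2 * ((riemannZetaZeroOrder (ρ : ℂ) : ℝ) / ‖(ρ : ℂ)‖ ^ 2 +
        (riemannZetaZeroOrder (ρ : ℂ) : ℝ) / ‖1 - (ρ : ℂ)‖ ^ 2) := by
        simp only [a, b, div_eq_mul_inv, inv_pow]; ring

end LiWeil

/-- **Remark (p0014:L1–6) AS PRINTED, RH-CONSEQUENCE (explicit binder):** under RH the Weil scalar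
product is positive DEFINITE on the Li class `L`: for every `F = Σ_{n ∈ S} c_n G_n` which is not
identically zero (off the poles `0, 1`), `‖F‖²_W = Σ_ρ m(ρ)|F(ρ)|² > 0`.  No convergence hypothesis:
the absolute convergence on `L` is `LiWeil.summable_order_mul_norm_sq_liClass`, and "`F` cannot vanish
at all points of `Z(π)`" is `LiWeil.exists_zero_liClass_ne_zero`.  WHAT THIS IS NOT: no positivity is
asserted unconditionally. [cite: Lagarias2007LiCoefficients, §3 remark (arXiv p0014:L1–6)] -/
theorem liWeilPairing_liClass_self_pos_of_riemannHypothesis (hRH : RiemannHypothesis) (S : Finset ℤ)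
    (c : ℤ → ℂ) (hF : ∃ s : ℂ, s ≠ 0 ∧ s ≠ 1 ∧ ∑ n ∈ S, c n * liTestFun n s ≠ 0) :
    0 < (liWeilPairing (fun s ↦ ∑ n ∈ S, c n * liTestFun n s)
      (fun s ↦ ∑ n ∈ S, c n * liTestFun n s)).re := by
  rw [liWeilPairing_self_eq_of_riemannHypothesis hRH, Complex.ofReal_re]
  obtain ⟨ρ₀, hρ₀⟩ := LiWeil.exists_zero_liClass_ne_zero S c hF
  exact (LiWeil.summable_order_mul_norm_sq_liClass S c).tsum_pos
    (fun ρ ↦ mul_nonneg (FordL33.order_pos ρ).le (sq_nonneg _)) ρ₀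
    (mul_pos (FordL33.order_pos ρ₀) (pow_pos (norm_pos_iff.2 hρ₀) 2))

/-! ## Dictionary with COLUMN 2: (3.1) on Mellin transforms of test functions is `W(g ⋆ g̃)` -/

/-- **(3.1) is Bombieri's zero form on test functions** (p0012:L21–26): for `ĝ = weilMellin g`,
`⟨ĝ, ĝ⟩_W = Σ_ρ m(ρ) ĝ(ρ) conj ĝ(1 − ρ̄) = WeilConverse.zeroForm g` — the same `tsum`, termwise.
RH-FREE. [cite: Lagarias2007LiCoefficients, §3 eq. (3.1) (p.12)] -/
theorem liWeilPairing_weilMellin_eq_zeroForm (g : ℝ → ℂ) :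
    liWeilPairing (weilMellin g) (weilMellin g) = WeilConverse.zeroForm g := by
  unfold liWeilPairing WeilConverse.zeroForm WeilConverse.pairCoeff
  rfl

/-- **(3.1) is Weil's quadratic functional** (p0012:L21–26 with Bombieri 2000 Thm 2): for a test
function `g` (`IsWeilTest g`: smooth, compactly supported), `⟨ĝ, ĝ⟩_W = W(g ⋆ g̃) = weilQuadratic g`.
Proof: both sides are the limit of the symmetric partial sums `Σ_{|Im ρ| ≤ T} m(ρ) (g ⋆ g̃)^(ρ)` —
the left by absolute convergence (`WeilConverse.hasWeilZeroSide_zeroForm`), the right by the tree's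
explicit formula (`explicit_formula_holds`). RH-FREE.
[cite: Lagarias2007LiCoefficients, §3 eq. (3.1) (p.12)] [cite: Bombieri2000Weil, Thm. 2] -/
theorem liWeilPairing_weilMellin_self_eq_weilQuadratic {g : ℝ → ℂ} (hg : IsWeilTest g) :
    liWeilPairing (weilMellin g) (weilMellin g) = weilQuadratic g := by
  rw [liWeilPairing_weilMellin_eq_zeroForm]
  exact tendsto_nhds_unique (WeilConverse.hasWeilZeroSide_zeroForm hg)
    (explicit_formula_holds (hg.weilConv hg.weilReflect))

/-- RH-CONSEQUENCE (binder explicit): under RH, `Re ⟨ĝ, ĝ⟩_W ≥ 0` for every test function `g` — the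
remark p0012:L38–45 («if RH holds for `π` … the Weil scalar product is positive semidefinite on `A`»)
on the subclass of Mellin transforms of test functions, i.e. the easy half of Weil's criterion
(`WeilPositivity.of_riemannHypothesis`) read through (3.1). WHAT THIS IS NOT: no positivity is
asserted unconditionally. [cite: Lagarias2007LiCoefficients, §3 remark after (3.1) (p.12)] -/
theorem liWeilPairing_weilMellin_self_nonneg_of_riemannHypothesis (hRH : RiemannHypothesis)
    {g : ℝ → ℂ} (hg : IsWeilTest g) :
    0 ≤ (liWeilPairing (weilMellin g) (weilMellin g)).re := by
  rw [liWeilPairing_weilMellin_self_eq_weilQuadratic hg]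
  exact WeilPositivity.of_riemannHypothesis explicit_formula_holds hRH g hg

end Literature.NumberTheory.LFunctions
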